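import Literature.NumberTheory.Automorphic.GLnIwahoriBorelFactorization
import Literature.NumberTheory.Automorphic.CongruenceSubgroupExpansionGL
import Literature.NumberTheory.Automorphic.CompactOpenAveraging
import HarnessLib

/-!
# Twisted averages over a principal congruence subgroup: the generic character of `K(L)` and
# the level of `ψ`-averages along `U_n`

Topic `NumberTheory/Automorphic`; namespace `Literature.NumberTheory.Automorphic`. Definitions with
bodies (`sdiagMat`, `congChar`, `congTwAvg`) and theorems; no named fact, no instance, no `sorry`.

Let `K_γ = congruenceGL n γ` (`γ < 1`) and let `χ` be an additive character of `F` trivial on the ball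
`{c : |c| ≤ γ²}`. Then `χ̃(g) = χ(∑_i g_{i,i+1})` (the generic character read off the superdiagonal)
is a **character of `K_γ`** (`congChar_mul`: the cross terms of `(gh)_{i,i+1}` are entries of
`(g - 1)(h - 1)`, of valuation `≤ γ²`), trivial on the lower triangular elements and on `K_{γ'}`,
`γ' ≤ γ²`. For a vector `y` fixed by a small `K_{γ₀} ≤ ker χ̃` the **twisted average**
`w = [K_γ : K_{γ₀}]⁻¹ ∑_{r ∈ K_γ/K_{γ₀}} χ̃(r)⁻¹ ρ(r) y` (`congTwAvg`, a finite transversal sum as in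
`CompactOpenAveraging`) is independent of the transversal, `(K_γ, χ̃)`-equivariant
(`apply_congTwAvg`), hence **fixed by `K_{γ'}` for `γ' ≤ γ²`** (`apply_congTwAvg_eq_self`); and when
`y` is fixed by the lower triangular part `K_γ ∩ B⁻` it equals the twisted average of `y` along the
upper unitriangular part `K_γ ∩ U_n` alone (`congTwAvg_eq_unipotent_sum`, through the product
transversal supplied by the Iwahori factorisation `K_γ = (K_γ ∩ U_n)(K_γ ∩ B⁻)`,
`isLeftTransversal_image_mul`), so that every `χ`-Whittaker functional sees through it
(`whittaker_congTwAvg`). This is the level-renormalisation step of the `p`-adic Kirillov bound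
(Jacquet–Shalika (1981), §1): a `ψ`-average along a large piece of `U_n` of a vector with lower
Iwahori invariance has again a compact open stabiliser of controlled size (Casselman (1995), §1.4;
Bernstein–Zelevinsky (1976), §3).

## References

* W. Casselman, *Introduction to the theory of admissible representations of `p`-adic reductive
  groups* (1995), §1.4 [Casselman1995].
* I. N. Bernstein, A. V. Zelevinsky, Russian Math. Surveys 31:3 (1976), §2.3, §3 [BernsteinZelevinsky1976].
* H. Jacquet, J. A. Shalika, Amer. J. Math. 103 (1981), §1 [JacquetShalikaAJM1981].
-/

noncomputable section

open scoped MatrixGroups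
open ValuativeRel Matrix

namespace Literature.NumberTheory.Automorphic

variable {F : Type*} [Field F] {n : ℕ}

/-! ### The superdiagonal sum of a matrix -/

/-- The sum of the superdiagonal entries `∑_i M_{i,i+1}` of a square matrix (`superdiagSum` on `U_n`). [folklore] -/
def sdiagMat (M : Matrix (Fin n) (Fin n) F) : F :=
  ∑ i : Fin n, ∑ j : Fin n, if (i : ℕ) + 1 = (j : ℕ) then M i j else 0

/-- `sdiagMat` is additive. [folklore] -/
theorem sdiagMat_add (M N : Matrix (Fin n) (Fin n) F) : sdiagMat (M + N) = sdiagMat M + sdiagMat N := by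
  simp only [sdiagMat, ← Finset.sum_add_distrib]
  refine Finset.sum_congr rfl fun i _ => Finset.sum_congr rfl fun j _ => ?_
  split_ifs <;> simp [Matrix.add_apply]

/-- `sdiagMat` of a difference. [folklore] -/
theorem sdiagMat_sub (M N : Matrix (Fin n) (Fin n) F) : sdiagMat (M - N) = sdiagMat M - sdiagMat N := by
  simp only [sdiagMat, ← Finset.sum_sub_distrib]
  refine Finset.sum_congr rfl fun i _ => Finset.sum_congr rfl fun j _ => ?_
  split_ifs <;> simp [Matrix.sub_apply]

/-- The identity has no superdiagonal. [folklore] -/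
@[simp] theorem sdiagMat_one : sdiagMat (1 : Matrix (Fin n) (Fin n) F) = 0 := by
  refine Finset.sum_eq_zero fun i _ => Finset.sum_eq_zero fun j _ => ?_
  split_ifs with h
  · rw [Matrix.one_apply_ne]; exact fun e => by rw [e] at h; omega
  · rfl

/-- On `U_n`, `sdiagMat` is `superdiagSum`. [folklore] -/
theorem sdiagMat_coe_upperUnitriangular (u : ↥(upperUnitriangular (Fin n) F)) :
    sdiagMat ((u : GL (Fin n) F) : Matrix (Fin n) (Fin n) F) = superdiagSum u := rfl

/-- A lower triangular matrix has no superdiagonal. [folklore] -/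
theorem sdiagMat_eq_zero_of_lower {b : GL (Fin n) F} (hb : b ∈ oppositeParabolicGL F (id : Fin n → Fin n)) :
    sdiagMat (b : Matrix (Fin n) (Fin n) F) = 0 := by
  refine Finset.sum_eq_zero fun i _ => Finset.sum_eq_zero fun j _ => ?_
  split_ifs with h
  · exact (mem_oppositeParabolicGL_iff b).1 hb i j (show i < j from Fin.lt_def.2 (by omega))
  · rfl

/-- **The cross terms**: `sdiag(gh) - sdiag(g) - sdiag(h) = sdiag((g - 1)(h - 1))`. [folklore] -/
theorem sdiagMat_mul_sub (g h : Matrix (Fin n) (Fin n) F) :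
    sdiagMat (g * h) - sdiagMat g - sdiagMat h = sdiagMat ((g - 1) * (h - 1)) := by
  have : (g - 1) * (h - 1) = g * h - g - h + 1 := by noncomm_ring
  rw [this, sdiagMat_add, sdiagMat_sub, sdiagMat_sub, sdiagMat_one, add_zero]

/-! ### The generic character of `K_γ` -/

/-- **The generic character** `χ̃(g) = χ(∑_i g_{i,i+1})` of a matrix, valued in `ℂ`. [folklore] -/
def congChar (χ : AddChar F Circle) (g : GL (Fin n) F) : ℂ := ((χ (sdiagMat (g : Matrix (Fin n) (Fin n) F)) : Circle) : ℂ)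

variable {χ : AddChar F Circle}

/-- `χ̃` has norm one. [folklore] -/
theorem norm_congChar (χ : AddChar F Circle) (g : GL (Fin n) F) : ‖congChar χ g‖ = 1 := Circle.norm_coe _

/-- `χ̃ ≠ 0`. [folklore] -/
theorem congChar_ne_zero (χ : AddChar F Circle) (g : GL (Fin n) F) : congChar χ g ≠ 0 := Circle.coe_ne_zero _

/-- `χ̃(1) = 1`. [folklore] -/
@[simp] theorem congChar_one (χ : AddChar F Circle) : congChar χ (1 : GL (Fin n) F) = 1 := by
  rw [congChar, Units.val_one, sdiagMat_one, AddChar.map_zero_eq_one, Circle.coe_one]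

/-- On `U_n`, `χ̃` is the standard generic character `whittakerCharFun χ`. [folklore] -/
theorem congChar_coe_upperUnitriangular (χ : AddChar F Circle) (u : ↥(upperUnitriangular (Fin n) F)) :
    congChar χ (u : GL (Fin n) F) = whittakerCharFun χ u := rfl

/-- `χ̃` is trivial on lower triangular elements. [folklore] -/
theorem congChar_eq_one_of_lower (χ : AddChar F Circle) {b : GL (Fin n) F}
    (hb : b ∈ oppositeParabolicGL F (id : Fin n → Fin n)) : congChar χ b = 1 := by
  rw [congChar, sdiagMat_eq_zero_of_lower hb, AddChar.map_zero_eq_one, Circle.coe_one]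


section Valued

variable [ValuativeRel F]

/-- An entrywise bound passes to the superdiagonal sum (ultrametric inequality). [folklore] -/
theorem valuation_sdiagMat_le {δ : ValueGroupWithZero F} {M : Matrix (Fin n) (Fin n) F} (hM : ValBound δ M) :
    valuation F (sdiagMat M) ≤ δ := by
  refine Valuation.map_sum_le _ fun i _ => Valuation.map_sum_le _ fun j _ => ?_
  split_ifs
  · exact hM i j
  · rw [map_zero]; exact zero_le

/-- **The cross terms on `K_γ` are small**: `|sdiag(gh) - sdiag(g) - sdiag(h)| ≤ γ²`. [folklore] -/
theorem valuation_sdiagMat_mul_sub_le {γ : ValueGroupWithZero F} {g h : GL (Fin n) F}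
    (hg : g ∈ congruenceGL n γ) (hh : h ∈ congruenceGL n γ) :
    valuation F (sdiagMat ((g * h : GL (Fin n) F) : Matrix (Fin n) (Fin n) F) - sdiagMat (g : Matrix (Fin n) (Fin n) F) -
      sdiagMat (h : Matrix (Fin n) (Fin n) F)) ≤ γ * γ := by
  rw [Units.val_mul, sdiagMat_mul_sub]
  exact valuation_sdiagMat_le (hg.2.1.mul hh.2.1)

/-- `χ̃` is trivial on `K_{γ'}` as soon as `χ` is trivial on the ball of radius `γ'`. [folklore] -/
theorem congChar_eq_one_of_mem_congruenceGL {γ' : ValueGroupWithZero F} (hχ : ∀ c : F, valuation F c ≤ γ' → χ c = 1)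
    {g : GL (Fin n) F} (hg : g ∈ congruenceGL n γ') : congChar χ g = 1 := by
  rw [congChar, hχ _ ?_, Circle.coe_one]
  have h := valuation_sdiagMat_le hg.2.1
  rwa [sdiagMat_sub, sdiagMat_one, sub_zero] at h

/-- **`χ̃` is a character of `K_γ`** when `χ` is trivial on the ball of radius `γ²`. [folklore] -/
theorem congChar_mul {γ : ValueGroupWithZero F} (hχ : ∀ c : F, valuation F c ≤ γ * γ → χ c = 1)
    {g h : GL (Fin n) F} (hg : g ∈ congruenceGL n γ) (hh : h ∈ congruenceGL n γ) :
    congChar χ (g * h) = congChar χ g * congChar χ h := by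
  have hc := hχ _ (valuation_sdiagMat_mul_sub_le hg hh)
  have e : sdiagMat ((g * h : GL (Fin n) F) : Matrix (Fin n) (Fin n) F) =
      sdiagMat (g : Matrix (Fin n) (Fin n) F) + sdiagMat (h : Matrix (Fin n) (Fin n) F) +
        (sdiagMat ((g * h : GL (Fin n) F) : Matrix (Fin n) (Fin n) F) - sdiagMat (g : Matrix (Fin n) (Fin n) F) -
          sdiagMat (h : Matrix (Fin n) (Fin n) F)) := by ring
  rw [congChar, e, AddChar.map_add_eq_mul, AddChar.map_add_eq_mul, hc, mul_one, Circle.coe_mul]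
  rfl

/-- `χ̃(g⁻¹) = χ̃(g)⁻¹` on `K_γ`. [folklore] -/
theorem congChar_inv {γ : ValueGroupWithZero F} (hχ : ∀ c : F, valuation F c ≤ γ * γ → χ c = 1)
    {g : GL (Fin n) F} (hg : g ∈ congruenceGL n γ) : congChar χ g⁻¹ = (congChar χ g)⁻¹ := by
  have h := congChar_mul hχ hg (Subgroup.inv_mem _ hg)
  rw [mul_inv_cancel, congChar_one] at h
  exact (eq_inv_of_mul_eq_one_right h.symm)

/-! ### Top-left corners as subgroups -/

omit [ValuativeRel F] in
/-- The subgroup of `GL_n(F)` of elements which are the identity outside the top-left `s × s` corner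
(`diag(GL_s, 1)`; all of `GL_n` for `s ≥ n`). [folklore] -/
def topLeftGL (F : Type*) [Field F] (n s : ℕ) : Subgroup (GL (Fin n) F) where
  carrier := {g | IsTopLeftNat s (g : Matrix (Fin n) (Fin n) F)}
  mul_mem' {g h} hg hh := by
    change IsTopLeftNat s ((g * h : GL (Fin n) F) : Matrix (Fin n) (Fin n) F)
    rw [Units.val_mul]; exact IsTopLeftNat.mul hg hh
  one_mem' := by
    change IsTopLeftNat s ((1 : GL (Fin n) F) : Matrix (Fin n) (Fin n) F)
    rw [Units.val_one]; exact isTopLeftNat_one s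
  inv_mem' {g} hg := IsTopLeftNat.inv hg

omit [ValuativeRel F] in
/-- Membership in `topLeftGL`. [folklore] -/
theorem mem_topLeftGL_iff {s : ℕ} {g : GL (Fin n) F} : g ∈ topLeftGL F n s ↔ IsTopLeftNat s (g : Matrix (Fin n) (Fin n) F) :=
  Iff.rfl

omit [ValuativeRel F] in
/-- For `s ≥ n` the top-left subgroup is everything. [folklore] -/
theorem topLeftGL_eq_top {s : ℕ} (hs : n ≤ s) : topLeftGL F n s = ⊤ :=
  eq_top_iff.2 fun _ _ => isTopLeftNat_of_le hs _

/-- **The top-left truncated congruence subgroup** `K_γ^{(s)} = K_γ ∩ diag(GL_s, 1)`. [folklore] -/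
abbrev congruenceTL (F : Type*) [Field F] [ValuativeRel F] (n : ℕ) (γ : ValueGroupWithZero F) (s : ℕ) :
    Subgroup (GL (Fin n) F) :=
  congruenceGL n γ ⊓ topLeftGL F n s

/-! ### The twisted average over `K_γ / K_{γ₀}` -/

variable {V : Type*} [AddCommGroup V] [Module ℂ V] (ρ : Representation ℂ (GL (Fin n) F) V)

/-- **The twisted average** `[K_γ : K_{γ₀}]⁻¹ ∑_{r ∈ R} χ̃(r)⁻¹ ρ(r) y` over a finite set `R` (meant to
be a transversal of `K_γ / K_{γ₀}` with `K_{γ₀}` fixing `y` and contained in `ker χ̃`). [folklore] -/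
def congTwAvg (χ : AddChar F Circle) (R : Finset (GL (Fin n) F)) (y : V) : V :=
  ((R.card : ℂ))⁻¹ • ∑ r ∈ R, (congChar χ r)⁻¹ • ρ r y

variable {ρ}

/-- **Admissible averaging data** in the top-left corner of size `s`: `γ < 1`, `χ` trivial on the ball of
radius `γ²`, a small level `γ₀ ≤ γ²` whose (top-left) congruence subgroup fixes `y`, and a transversal `R` of
`K_γ^{(s)} / K_γ^{(s)} ∩ K_{γ₀}`. (`s ≥ n`: the whole `K_γ`.) [folklore] -/
structure IsCongAvgData (ρ : Representation ℂ (GL (Fin n) F) V) (χ : AddChar F Circle)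
    (γ γ₀ : ValueGroupWithZero F) (s : ℕ) (R : Finset (GL (Fin n) F)) (y : V) : Prop where
  hγ : γ < 1
  hγ₀ : γ₀ ≤ γ * γ
  hχ : ∀ c : F, valuation F c ≤ γ * γ → χ c = 1
  trans : IsLeftTransversal (congruenceTL F n γ s) (congruenceTL F n γ s ⊓ congruenceGL n γ₀) R
  fix : ∀ g ∈ congruenceGL n γ₀ ⊓ topLeftGL F n s, ρ g y = y

namespace IsCongAvgData

variable {γ γ₀ : ValueGroupWithZero F} {s : ℕ} {R : Finset (GL (Fin n) F)} {y : V}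

/-- `γ₀ ≤ γ` (since `γ ≤ 1`). [folklore] -/
theorem hγ₀γ (h : IsCongAvgData ρ χ γ γ₀ s R y) : γ₀ ≤ γ :=
  h.hγ₀.trans (by simpa using mul_le_mul' (le_refl γ) h.hγ.le)

/-- The summand `r ↦ χ̃(r)⁻¹ ρ(r) y` is right `K_γ^{(s)} ∩ K_{γ₀}`-invariant on `K_γ^{(s)}`. [folklore] -/
theorem summand_mul (h : IsCongAvgData ρ χ γ γ₀ s R y) {x : GL (Fin n) F} (hx : x ∈ congruenceTL F n γ s)
    {s' : GL (Fin n) F} (hs : s' ∈ congruenceTL F n γ s ⊓ congruenceGL n γ₀) :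
    (congChar χ (x * s'))⁻¹ • ρ (x * s') y = (congChar χ x)⁻¹ • ρ x y := by
  rw [congChar_mul h.hχ hx.1 hs.1.1, congChar_eq_one_of_mem_congruenceGL (fun c hc => h.hχ c (hc.trans h.hγ₀)) hs.2,
    mul_one, map_mul, Module.End.mul_apply, h.fix s' ⟨hs.2, hs.1.2⟩]

/-- **Independence of the transversal.** [folklore] -/
theorem congTwAvg_eq (h : IsCongAvgData ρ χ γ γ₀ s R y) {R' : Finset (GL (Fin n) F)} (h' : IsCongAvgData ρ χ γ γ₀ s R' y) :
    congTwAvg ρ χ R y = congTwAvg ρ χ R' y := by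
  have hsum := h.trans.sum_eq_sum_of_isLeftTransversal h'.trans (fun r => (congChar χ r)⁻¹ • ρ r y)
    (fun x hx s hs => h.summand_mul hx hs)
  have hcard := h.trans.sum_eq_sum_of_isLeftTransversal h'.trans (fun _ => (1 : ℕ)) (fun _ _ _ _ => rfl)
  simp only [Finset.sum_const, smul_eq_mul, mul_one] at hcard
  rw [congTwAvg, congTwAvg, hsum, hcard]

/-- **Equivariance**: `ρ(g) w = χ̃(g) w` for `g ∈ K_γ^{(s)}`. [folklore] -/
theorem apply_congTwAvg (h : IsCongAvgData ρ χ γ γ₀ s R y) {g : GL (Fin n) F} (hg : g ∈ congruenceTL F n γ s) :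
    ρ g (congTwAvg ρ χ R y) = congChar χ g • congTwAvg ρ χ R y := by
  have hsum := h.trans.sum_mul_left (fun r => (congChar χ r)⁻¹ • ρ r y) (fun x hx s hs => h.summand_mul hx hs) hg
  have hterm : ∀ r ∈ R, ρ g ((congChar χ r)⁻¹ • ρ r y) = congChar χ g • ((congChar χ (g * r))⁻¹ • ρ (g * r) y) := by
    intro r hr
    rw [map_smul, ← Module.End.mul_apply, ← map_mul, congChar_mul h.hχ hg.1 (h.trans.mem_of_mem r hr).1, mul_inv, smul_smul,
      ← mul_assoc, mul_inv_cancel₀ (congChar_ne_zero χ g), one_mul]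
  rw [congTwAvg, map_smul, map_sum, Finset.sum_congr rfl hterm, ← Finset.smul_sum, hsum, smul_comm]

/-- **The level of the twisted average**: `w` is fixed by `K_{γ'}^{(s)}` for `γ' ≤ γ²` (`χ` is trivial on the
ball of radius `γ'` since `γ' ≤ γ²`). [folklore] -/
theorem apply_congTwAvg_eq_self (h : IsCongAvgData ρ χ γ γ₀ s R y) {γ' : ValueGroupWithZero F} (hγ' : γ' ≤ γ * γ)
    {g : GL (Fin n) F} (hg : g ∈ congruenceTL F n γ' s) : ρ g (congTwAvg ρ χ R y) = congTwAvg ρ χ R y := by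
  have hγ'γ : γ' ≤ γ := hγ'.trans (by simpa using mul_le_mul' (le_refl γ) h.hγ.le)
  rw [h.apply_congTwAvg ⟨congruenceGL_mono hγ'γ hg.1, hg.2⟩,
    congChar_eq_one_of_mem_congruenceGL (fun c hc => h.hχ c (hc.trans hγ')) hg.1, one_smul]

/-- **Lower triangular elements of `K_γ^{(s)}` fix the twisted average** (their generic character is `1`).
[folklore] -/
theorem apply_congTwAvg_eq_self_of_lower (h : IsCongAvgData ρ χ γ γ₀ s R y) {b : GL (Fin n) F}
    (hb : b ∈ congruenceTL F n γ s) (hbl : b ∈ oppositeParabolicGL F (id : Fin n → Fin n)) :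
    ρ b (congTwAvg ρ χ R y) = congTwAvg ρ χ R y := by
  rw [h.apply_congTwAvg hb, congChar_eq_one_of_lower χ hbl, one_smul]

end IsCongAvgData

/-! ### The product transversal from the Iwahori factorisation -/

section Product

variable {γ γ₀ : ValueGroupWithZero F}

/-- Elements of `U_n ∩ (K_γ ∩ B⁻) K_{γ₀}` lie in `K_{γ₀}`: if `u = b k` with `u` upper unitriangular, `b`
lower triangular in `K_γ` and `k ∈ K_{γ₀}`, `γ₀ ≤ γ < 1`, then `u ∈ K_{γ₀}` (uniqueness of the Iwahori
factorisation of `k⁻¹ = u⁻¹ b`). [folklore] -/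
theorem mem_congruenceGL_of_unitriangular_eq_lower_mul (hγ₀1 : γ₀ < 1) {u b k : GL (Fin n) F}
    (hu : u ∈ upperUnitriangular (Fin n) F) (hb : b ∈ oppositeParabolicGL F (id : Fin n → Fin n))
    (hk : k ∈ congruenceGL n γ₀) (h : u = b * k) : u ∈ congruenceGL n γ₀ := by
  obtain ⟨u₂, b₂, hu₂, hb₂, hu₂K, -, hk2⟩ := exists_unitriangular_mul_lower_of_mem_congruenceGL' hγ₀1 (Subgroup.inv_mem _ hk)
  -- `k⁻¹ = u⁻¹ b = u₂ b₂`
  have e : u⁻¹ * b = u₂ * b₂ := by rw [← hk2, h]; group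
  have := (unitriangular_mul_lower_unique (Subgroup.inv_mem _ hu) hu₂ hb hb₂ e).1
  rw [inv_eq_iff_eq_inv] at this
  rw [this]; exact Subgroup.inv_mem _ hu₂K

/-- **The product transversal.** Let `γ₀ ≤ γ < 1`, `R_N` a transversal of `K_γ^{(s)} ∩ U_n` modulo `K_{γ₀}` and
`R_B` a transversal of `K_γ^{(s)} ∩ B⁻` modulo `K_{γ₀}` (`K_γ^{(s)} = congruenceTL`, the top-left corner of
size `s`). Then `{u b : u ∈ R_N, b ∈ R_B}` is a transversal of `K_γ^{(s)}` modulo `K_{γ₀}` (existence of the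
top-left compatible Iwahori factorisation, normality of `K_{γ₀}` in `GL_n(𝒪)` and the previous lemma for
uniqueness). [folklore] -/
theorem isLeftTransversal_image_mul [DecidableEq (GL (Fin n) F)] (hγ : γ < 1) (hγ₀γ : γ₀ ≤ γ) (s : ℕ)
    {R_N R_B : Finset (GL (Fin n) F)}
    (hN : IsLeftTransversal (congruenceTL F n γ s ⊓ upperUnitriangular (Fin n) F)
      ((congruenceTL F n γ s ⊓ upperUnitriangular (Fin n) F) ⊓ congruenceGL n γ₀) R_N)
    (hB : IsLeftTransversal (congruenceTL F n γ s ⊓ oppositeParabolicGL F (id : Fin n → Fin n))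
      ((congruenceTL F n γ s ⊓ oppositeParabolicGL F (id : Fin n → Fin n)) ⊓ congruenceGL n γ₀) R_B) :
    IsLeftTransversal (congruenceTL F n γ s) (congruenceTL F n γ s ⊓ congruenceGL n γ₀)
      ((R_N ×ˢ R_B).image fun p => p.1 * p.2) := by
  have hγ₀1 : γ₀ < 1 := hγ₀γ.trans_lt hγ
  refine ⟨fun x hx => ?_, fun g hg => ?_⟩
  · obtain ⟨p, hp, rfl⟩ := Finset.mem_image.1 hx
    obtain ⟨hp1, hp2⟩ := Finset.mem_product.1 hp
    exact Subgroup.mul_mem _ (hN.mem_of_mem _ hp1).1 (hB.mem_of_mem _ hp2).1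
  · obtain ⟨u, b, hu, hb, huK, hbK, hus, hbs, rfl⟩ := exists_unitriangular_mul_lower_of_mem_congruenceGL hγ s hg.1 hg.2
    -- the representatives of `u` and `b`
    set u₀ := hN.rep u with hu₀
    set b₀ := hB.rep b with hb₀
    have huB : u ∈ congruenceTL F n γ s ⊓ upperUnitriangular (Fin n) F := ⟨⟨huK, hus⟩, hu⟩
    have hbB : b ∈ congruenceTL F n γ s ⊓ oppositeParabolicGL F (id : Fin n → Fin n) := ⟨⟨hbK, hbs⟩, hb⟩
    have hu₀R : u₀ ∈ R_N := hN.rep_mem huB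
    have hb₀R : b₀ ∈ R_B := hB.rep_mem hbB
    have hnu : u₀⁻¹ * u ∈ congruenceGL n γ₀ := (hN.rep_inv_mul_mem huB).2
    have hmb : b₀⁻¹ * b ∈ congruenceGL n γ₀ := (hB.rep_inv_mul_mem hbB).2
    have hb₀K : b₀ ∈ congruenceTL F n γ s := (hB.mem_of_mem _ hb₀R).1
    have hu₀K : u₀ ∈ congruenceTL F n γ s := (hN.mem_of_mem _ hu₀R).1
    refine ⟨u₀ * b₀, ⟨Finset.mem_image.2 ⟨(u₀, b₀), Finset.mem_product.2 ⟨hu₀R, hb₀R⟩, rfl⟩, ?_⟩, ?_⟩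
    · -- `(u₀ b₀)⁻¹ (u b) = b₀⁻¹ (u₀⁻¹ u) b₀ · (b₀⁻¹ b) ∈ K_{γ₀}`
      refine ⟨Subgroup.mul_mem _ (Subgroup.inv_mem _ (Subgroup.mul_mem _ hu₀K hb₀K)) hg, ?_⟩
      have e : (u₀ * b₀)⁻¹ * (u * b) = (b₀⁻¹ * (u₀⁻¹ * u) * b₀⁻¹⁻¹) * (b₀⁻¹ * b) := by group
      rw [e]
      exact Subgroup.mul_mem _ (conj_mem_congruenceGL (congruenceGL_le_glInt _ (Subgroup.inv_mem _ hb₀K.1)) hnu) hmb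
    · -- uniqueness
      rintro x ⟨hx, hxg⟩
      obtain ⟨p, hp, rfl⟩ := Finset.mem_image.1 hx
      obtain ⟨hp1, hp2⟩ := Finset.mem_product.1 hp
      have hp1K : p.1 ∈ congruenceTL F n γ s := (hN.mem_of_mem _ hp1).1
      have hp2K : p.2 ∈ congruenceTL F n γ s := (hB.mem_of_mem _ hp2).1
      -- `w := p.1⁻¹ u = p.2 k b⁻¹` with `k = (p.1 p.2)⁻¹ (u b) ∈ K_{γ₀}`
      set k : GL (Fin n) F := (p.1 * p.2)⁻¹ * (u * b) with hk
      have hkK : k ∈ congruenceGL n γ₀ := hxg.2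
      have e1 : p.1⁻¹ * u = (p.2 * b⁻¹) * (b * k * b⁻¹) := by rw [hk]; group
      have hk' : b * k * b⁻¹ ∈ congruenceGL n γ₀ := conj_mem_congruenceGL (congruenceGL_le_glInt _ hbK) hkK
      have hw : p.1⁻¹ * u ∈ congruenceGL n γ₀ :=
        mem_congruenceGL_of_unitriangular_eq_lower_mul hγ₀1
          (Subgroup.mul_mem _ (Subgroup.inv_mem _ (hN.mem_of_mem _ hp1).2) hu)
          (Subgroup.mul_mem _ (hB.mem_of_mem _ hp2).2 (Subgroup.inv_mem _ hb)) hk' e1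
      have h1 : p.1 = u₀ := by
        refine (hN.rep_eq_of huB hp1 ⟨⟨Subgroup.mul_mem _ (Subgroup.inv_mem _ hp1K) ⟨huK, hus⟩,
          Subgroup.mul_mem _ (Subgroup.inv_mem _ (hN.mem_of_mem _ hp1).2) hu⟩, hw⟩).symm
      have h2 : p.2 = b₀ := by
        refine (hB.rep_eq_of hbB hp2 ⟨⟨Subgroup.mul_mem _ (Subgroup.inv_mem _ hp2K) ⟨hbK, hbs⟩,
          Subgroup.mul_mem _ (Subgroup.inv_mem _ (hB.mem_of_mem _ hp2).2) hb⟩, ?_⟩).symm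
        -- `b p.2⁻¹ = (b k b⁻¹) (p.1⁻¹ u)⁻¹ ∈ K_{γ₀}`, then conjugate by `b⁻¹`
        have e2 : b * p.2⁻¹ = (b * k * b⁻¹) * (p.1⁻¹ * u)⁻¹ := by rw [e1]; group
        have h3 : b * p.2⁻¹ ∈ congruenceGL n γ₀ := by rw [e2]; exact Subgroup.mul_mem _ hk' (Subgroup.inv_mem _ hw)
        have e3 : p.2⁻¹ * b = b⁻¹ * (b * p.2⁻¹) * b⁻¹⁻¹ := by group
        rw [e3]
        exact conj_mem_congruenceGL (congruenceGL_le_glInt _ (Subgroup.inv_mem _ hbK)) h3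
      rw [h1, h2]

omit [ValuativeRel F] in
/-- The multiplication map is injective on `R_N × R_B` (uniqueness of the Iwahori factorisation). [folklore] -/
theorem injOn_mul_of_transversals {R_N R_B : Finset (GL (Fin n) F)}
    (hN : ∀ u ∈ R_N, u ∈ upperUnitriangular (Fin n) F) (hB : ∀ b ∈ R_B, b ∈ oppositeParabolicGL F (id : Fin n → Fin n)) :
    Set.InjOn (fun p : GL (Fin n) F × GL (Fin n) F => p.1 * p.2) ((R_N ×ˢ R_B : Finset _) : Set (GL (Fin n) F × GL (Fin n) F)) := by
  intro p hp p' hp' h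
  rw [Finset.coe_product] at hp hp'
  obtain ⟨e1, e2⟩ := unitriangular_mul_lower_unique (hN _ hp.1) (hN _ hp'.1) (hB _ hp.2) (hB _ hp'.2) h
  exact Prod.ext e1 e2

end Product

/-! ### The twisted average of a vector with lower Iwahori invariance -/

section Lower

variable {γ γ₀ : ValueGroupWithZero F} {y : V}

/-- **The twisted average along `U_n` alone.** If `y` is fixed by `K_{γ₀}` and by the lower triangular part
`K_γ ∩ B⁻`, then for transversals `R_N` of `K_γ ∩ U_n` and `R_B` of `K_γ ∩ B⁻` modulo `K_{γ₀}` the twisted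
average over the product transversal is the twisted average over `R_N`:
`congTwAvg (R_N R_B) y = (#R_N)⁻¹ ∑_{u ∈ R_N} χ̃(u)⁻¹ ρ(u) y`. [folklore] -/
theorem congTwAvg_eq_unipotent_sum [DecidableEq (GL (Fin n) F)]
    (hχ : ∀ c : F, valuation F c ≤ γ * γ → χ c = 1)
    {R_N R_B : Finset (GL (Fin n) F)}
    (hN : ∀ u ∈ R_N, u ∈ congruenceGL n γ ⊓ upperUnitriangular (Fin n) F)
    (hB : ∀ b ∈ R_B, b ∈ congruenceGL n γ ⊓ oppositeParabolicGL F (id : Fin n → Fin n)) (hRB : R_B.Nonempty)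
    (hfixB : ∀ b ∈ R_B, ρ b y = y) :
    congTwAvg ρ χ ((R_N ×ˢ R_B).image fun p => p.1 * p.2) y =
      ((R_N.card : ℂ))⁻¹ • ∑ u ∈ R_N, (congChar χ u)⁻¹ • ρ u y := by
  have hinj := injOn_mul_of_transversals (fun u hu => (hN u hu).2) (fun b hb => (hB b hb).2) (R_N := R_N) (R_B := R_B)
  rw [congTwAvg, Finset.card_image_of_injOn hinj, Finset.sum_image hinj, Finset.card_product, Finset.sum_product]
  have hterm : ∀ u ∈ R_N, ∀ b ∈ R_B, (congChar χ (u * b))⁻¹ • ρ (u * b) y = (congChar χ u)⁻¹ • ρ u y := by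
    intro u hu b hb
    rw [congChar_mul hχ (hN u hu).1 (hB b hb).1, congChar_eq_one_of_lower χ (hB b hb).2, mul_one, map_mul,
      Module.End.mul_apply, hfixB b hb]
  rw [Finset.sum_congr rfl fun u hu => Finset.sum_congr rfl fun b hb => hterm u hu b hb]
  simp only [Finset.sum_const, Finset.smul_sum]
  refine Finset.sum_congr rfl fun u _ => ?_
  rw [← Nat.cast_smul_eq_nsmul ℂ, smul_smul, Nat.cast_mul, mul_inv, mul_assoc, inv_mul_cancel₀
    (Nat.cast_ne_zero.2 (Finset.card_pos.2 hRB).ne'), mul_one]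

/-- **Whittaker functionals see through the twisted average** of a vector with lower Iwahori
invariance: `Λ(w) = Λ(y)` for every `χ`-Whittaker functional `Λ`. [folklore] -/
theorem whittaker_congTwAvg [DecidableEq (GL (Fin n) F)]
    (hχ : ∀ c : F, valuation F c ≤ γ * γ → χ c = 1)
    {R_N R_B : Finset (GL (Fin n) F)}
    (hN : ∀ u ∈ R_N, u ∈ congruenceGL n γ ⊓ upperUnitriangular (Fin n) F)
    (hB : ∀ b ∈ R_B, b ∈ congruenceGL n γ ⊓ oppositeParabolicGL F (id : Fin n → Fin n))
    (hRN : R_N.Nonempty) (hRB : R_B.Nonempty) (hfixB : ∀ b ∈ R_B, ρ b y = y)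
    {Λ : Module.Dual ℂ V} (hΛ : Λ ∈ whittakerFunctionals ρ χ) :
    Λ (congTwAvg ρ χ ((R_N ×ˢ R_B).image fun p => p.1 * p.2) y) = Λ y := by
  rw [congTwAvg_eq_unipotent_sum hχ hN hB hRB hfixB, map_smul, map_sum]
  have : ∀ u ∈ R_N, Λ ((congChar χ u)⁻¹ • ρ u y) = Λ y := by
    intro u hu
    rw [map_smul, smul_eq_mul,
      show ρ u y = ρ ((⟨u, (hN u hu).2⟩ : ↥(upperUnitriangular (Fin n) F)) : GL (Fin n) F) y from rfl,
      (mem_whittakerFunctionals_iff Λ).1 hΛ, ← congChar_coe_upperUnitriangular, ← mul_assoc, inv_mul_cancel₀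
        (congChar_ne_zero χ u), one_mul]
  rw [Finset.sum_congr rfl this, Finset.sum_const, ← Nat.cast_smul_eq_nsmul ℂ, smul_smul,
    inv_mul_cancel₀ (Nat.cast_ne_zero.2 (Finset.card_pos.2 hRN).ne'), one_smul]

end Lower

end Valued

end Literature.NumberTheory.Automorphic
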